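import Literature.NumberTheory.Automorphic.HarrisLanTaylorThorneCor627
import HarnessLib

/-!
# `HasTwoPrimesOver` and the `ncard (primesOver) = 2` convention — bridge lemmas

Topic `Literature/NumberTheory/Automorphic`; sibling proofs file of `HarrisLanTaylorThorneCor627`,
which renders "the rational prime `q` splits in the (imaginary quadratic) field `F₀`"
(Harris–Lan–Taylor–Thorne 2016, p. 11 and Cor. 6.27) as `NumberField.HasTwoPrimesOver F₀ q`:
two distinct finite places `w ≠ w'` of `F₀` with `q ∈ w`, `q ∈ w'`.  Elsewhere the tree renders
the same condition as `((Ideal.span {(q : ℤ)}).primesOver (𝓞 F₀)).ncard = 2` (e.g.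
`Literature/Barriers/BirchSwinnertonDyer/PAdicHeightNondegeneracy`).  This file proves the two
agree (review advisory on `HasTwoPrimesOver`):

* `Literature.NumberTheory.Automorphic.natCast_mem_asIdeal_iff_mem_primesOver` — for a rational prime `q` and a finite place `w`
  of a number field, `(q : 𝓞 F₀) ∈ w ↔ w ∈ primesOver (q)`;
* `NumberField.hasTwoPrimesOver_iff_one_lt_ncard` — `HasTwoPrimesOver F₀ q ↔ 1 < #primesOver (q)`
  (any number field, `q` prime);
* `Literature.NumberTheory.Automorphic.ncard_primesOver_span_le_finrank` — `#primesOver (q) ≤ [F₀ : ℚ]` (from Mathlib's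
  fundamental identity `Ideal.sum_ramification_inertia_eq_finrank`, each `e f ≥ 1`);
* `NumberField.hasTwoPrimesOver_iff_ncard_eq_two` — for `[F₀ : ℚ] = 2`:
  `HasTwoPrimesOver F₀ q ↔ #primesOver (q) = 2`, i.e. "`q` splits in `F₀`";
* `NumberField.hasSplitImaginaryQuadraticSubfield_iff_ncard` — the same for the standing
  hypothesis `HasSplitImaginaryQuadraticSubfield K p` ("`K ⊇ F₀` imaginary quadratic with `p`
  split").

## References

* M. Harris, K.-W. Lan, R. Taylor, J. Thorne, *On the rigid cohomology of certain Shimura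
  varieties*, Res. Math. Sci. 3:37 (2016), p. 11 ("a rational prime `p` which splits in `F₀`").
  [HarrisLanTaylorThorneRMS2016]
* J. Neukirch, *Algebraic Number Theory* (1999), Ch. I §8: Prop. (8.2) (fundamental identity
  `∑ eᵢ fᵢ = n`) and the paragraph after the proof of Prop. (8.3) ("split completely",
  "nonsplit"). [NeukirchANT1999]
-/

open NumberField IsDedekindDomain Ideal

namespace Literature.NumberTheory.Automorphic

variable (F₀ : Type*) [Field F₀]

/-- For a rational prime `q` and a non-zero prime `w` of `𝓞 F₀`: `q ∈ w` iff `w` lies over the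
ideal `(q)` of `ℤ` (the prime ideal `w ∩ ℤ` contains `q`, and `(q)` is maximal).  General
helper; candidate for Mathlib (`RingTheory/Ideal/Int`). [folklore] -/
theorem natCast_mem_asIdeal_iff_mem_primesOver {q : ℕ} (hq : q.Prime)
    (w : HeightOneSpectrum (𝓞 F₀)) :
    ((q : ℕ) : 𝓞 F₀) ∈ w.asIdeal ↔ w.asIdeal ∈ (Ideal.span {(q : ℤ)}).primesOver (𝓞 F₀) := by
  haveI := Fact.mk hq
  constructor
  · intro h
    refine ⟨w.isPrime, ⟨?_⟩⟩
    refine (Int.ideal_span_isMaximal_of_prime q).eq_of_le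
      (Ideal.IsPrime.under ℤ w.asIdeal).ne_top ?_
    rw [Ideal.span_singleton_le_iff_mem, Ideal.mem_comap]
    simpa using h
  · rintro ⟨-, hover⟩
    have : (q : ℤ) ∈ w.asIdeal.under ℤ := by
      rw [← hover.over]
      exact Ideal.mem_span_singleton_self _
    rw [Ideal.mem_comap] at this
    simpa using this

variable [NumberField F₀]

/-- **At most `[F₀ : ℚ]` primes lie over a rational prime** `q` in a number field `F₀`: by the
fundamental identity `∑_{P | q} e_P f_P = [𝓞_{F₀} : ℤ] = [F₀ : ℚ]` (Mathlib
`Ideal.sum_ramification_inertia_eq_finrank`, `NumberField.RingOfIntegers.rank`) with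
`e_P, f_P ≥ 1` (`Ideal.ramificationIdx_pos`, `Ideal.inertiaDeg_pos`).  Neukirch, Ch. I, Prop. (8.2).
[cite: NeukirchANT1999, Ch. I Prop. (8.2)] -/
theorem ncard_primesOver_span_le_finrank {q : ℕ} (hq : q.Prime) :
    ((Ideal.span {(q : ℤ)}).primesOver (𝓞 F₀)).ncard ≤ Module.finrank ℚ F₀ := by
  haveI := Fact.mk hq
  rw [← RingOfIntegers.rank F₀,
    ← Ideal.sum_ramification_inertia_eq_finrank (Ideal.span {(q : ℤ)}) (𝓞 F₀),
    ← Set.fintypeCard_eq_ncard, ← Finset.card_univ, Finset.card_eq_sum_ones]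
  refine Finset.sum_le_sum fun P _ ↦ ?_
  haveI : P.1.IsPrime := P.2.1
  exact Nat.mul_pos (Ideal.ramificationIdx_pos P.1 ℤ) (Ideal.inertiaDeg_pos P.1 ℤ)

end Literature.NumberTheory.Automorphic

namespace NumberField

variable (F₀ : Type*) [Field F₀] [NumberField F₀]

/-- `HasTwoPrimesOver F₀ q` (two distinct finite places of `F₀` containing the rational prime `q`)
says exactly that **more than one prime of `𝓞 F₀` lies over `(q)`**
(`Literature.NumberTheory.Automorphic.natCast_mem_asIdeal_iff_mem_primesOver`; the set of primes over `(q)` is finite, Mathlib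
`IsDedekindDomain.primesOver_finite`). [folklore] -/
theorem hasTwoPrimesOver_iff_one_lt_ncard {q : ℕ} (hq : q.Prime) :
    HasTwoPrimesOver F₀ q ↔ 1 < ((Ideal.span {(q : ℤ)}).primesOver (𝓞 F₀)).ncard := by
  haveI := Fact.mk hq
  have hfin : ((Ideal.span {(q : ℤ)}).primesOver (𝓞 F₀)).Finite :=
    IsDedekindDomain.primesOver_finite _ _
  have hqb : Ideal.span {(q : ℤ)} ≠ ⊥ := by simpa using hq.ne_zero
  rw [Set.one_lt_ncard_iff hfin]
  constructor
  · rintro ⟨w, w', hne, hw, hw'⟩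
    exact ⟨w.asIdeal, w'.asIdeal, (Literature.NumberTheory.Automorphic.natCast_mem_asIdeal_iff_mem_primesOver F₀ hq w).mp hw,
      (Literature.NumberTheory.Automorphic.natCast_mem_asIdeal_iff_mem_primesOver F₀ hq w').mp hw',
      fun h ↦ hne (HeightOneSpectrum.ext h)⟩
  · rintro ⟨P, P', hP, hP', hne⟩
    exact ⟨⟨P, hP.1, ne_bot_of_mem_primesOver hqb hP⟩,
      ⟨P', hP'.1, ne_bot_of_mem_primesOver hqb hP'⟩,
      fun h ↦ hne (congrArg HeightOneSpectrum.asIdeal h),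
      (Literature.NumberTheory.Automorphic.natCast_mem_asIdeal_iff_mem_primesOver F₀ hq ⟨P, hP.1, _⟩).mpr hP,
      (Literature.NumberTheory.Automorphic.natCast_mem_asIdeal_iff_mem_primesOver F₀ hq ⟨P', hP'.1, _⟩).mpr hP'⟩

/-- **Bridge to the `ncard = 2` convention.**  For a quadratic field `F₀` (`[F₀ : ℚ] = 2`) and a
rational prime `q`: `HasTwoPrimesOver F₀ q` iff exactly two primes of `𝓞 F₀` lie over `(q)`
(`#primesOver (q) = 2`, the rendering of "`q` splits in `F₀`" used elsewhere in the tree), since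
`#primesOver (q) ≤ [F₀ : ℚ] = 2` (`Literature.NumberTheory.Automorphic.ncard_primesOver_span_le_finrank`).  Neukirch, Ch. I §8
(after Prop. (8.3): "split completely" means `r = n`). [cite: NeukirchANT1999, Ch. I §8 (8.2)] -/
theorem hasTwoPrimesOver_iff_ncard_eq_two {q : ℕ} (hq : q.Prime)
    (h2 : Module.finrank ℚ F₀ = 2) :
    HasTwoPrimesOver F₀ q ↔ ((Ideal.span {(q : ℤ)}).primesOver (𝓞 F₀)).ncard = 2 := by
  have hle := Literature.NumberTheory.Automorphic.ncard_primesOver_span_le_finrank F₀ hq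
  rw [hasTwoPrimesOver_iff_one_lt_ncard F₀ hq]
  omega

/-- The standing hypothesis `HasSplitImaginaryQuadraticSubfield K p` of
`HarrisLanTaylorThorneCor627` ("`K` contains an imaginary quadratic field `F₀` in which `p`
splits", HLTT p. 11) in the `ncard = 2` convention: some subfield `F₀ ⊆ K` with `[F₀ : ℚ] = 2`,
totally complex, has exactly two primes over `(p)`.
[cite: HarrisLanTaylorThorneRMS2016, §1 (p. 11)] -/
theorem hasSplitImaginaryQuadraticSubfield_iff_ncard (K : Type*) [Field K] [NumberField K]
    {p : ℕ} (hp : p.Prime) :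
    HasSplitImaginaryQuadraticSubfield K p ↔
      ∃ F₀ : IntermediateField ℚ K, (Module.finrank ℚ F₀ = 2 ∧ IsTotallyComplex F₀) ∧
        ((Ideal.span {(p : ℤ)}).primesOver (𝓞 F₀)).ncard = 2 := by
  rw [hasSplitImaginaryQuadraticSubfield_iff]
  refine exists_congr fun F₀ ↦ and_congr_right fun hF₀ ↦ ?_
  exact hasTwoPrimesOver_iff_ncard_eq_two F₀ hp hF₀.1

end NumberField
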